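import Mathlib
import Summits.ValiantsHypothesis.ValiantsHypothesis.Theorems.LacunarySymmetroidMatrixDescartesInertiaWindow

/-!
# `MatrixDescartes` (stmt-ValiantsHypothesis-18050) — INERTIA KIT, IV-a: THE INDEX TELESCOPE — across a window with
# non-singular ends the negative index of a continuous symmetric family changes by EXACTLY the sum of its prescribed
# one-sided jumps at the interior singular points

HONEST FRAMING.  Cell `pub-symmetroid`, seat `val-sym-mdr-p2` (gen 17); helper file `--supports` the crux
`Theses.LacunarySymmetroid.MatrixDescartes`, NO closure claim.  General point-set bookkeeping for an entrywise-continuous hermitian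
family `F : ℝ → Matrix ι ι ℝ` (every lacunary symmetric pencil at every format is one); the equality companion of the window
INEQUALITY of `…InertiaWindow` (`Inertia.negIndex_le_add_sum_corank`), to be fed with the exact one-sided jumps of the SIGNATURE
LAW (`…InertiaJump`, `…InertiaJumpPencil`).  Nothing here bears on the crux in its window, on `stub_twoSided`, on `DoorA26`/`DoorA34`,
registers, or `VP ≠ VNP`.

CONTENT (`ν(A) = card {j // hA.eigenvalues j < 0}`).  Data: a finite set `T` containing every singular point of `F` in `[a, b]`,
non-singular ends `a < b`, and jump data `jr, jl : ℝ → ℕ` such that at every `t ∈ T ∩ (a, b)` one has `ν(F x) = ν(F t) + jr t` for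
`x > t` near `t` and `ν(F x) = ν(F t) + jl t` for `x < t` near `t`.  THE INDEX TELESCOPE (`negIndex_telescope`):
`ν(F b) + ∑_{t ∈ T ∩ (a,b)} jl t = ν(F a) + ∑_{t ∈ T ∩ (a,b)} jr t` — i.e. `ν(F b) − ν(F a) = ∑ (jr − jl)`, the net INDEX DRIFT is the
sum of the signed jumps.  Ingredients: `ν` is locally constant at non-singular points (`Inertia.eventually_negIndex_eq`) hence
constant on singular-free intervals (`DefiniteMoments.constant_of_nhds`); the complement of a finite set is open, so next to each
singular point there are non-singular scales realising the one-sided values with no singular point in between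
(`exists_point_left/right`); induction on the number of interior singular points.  The positive index has the same telescope
(`posIndex_telescope`, via `ν(−A) = π(A)`, tree `Inertia.posIndex_eq_negIndex_neg`). [folklore]; axioms standard; no definitions.
-/

-- layout Summits/ValiantsHypothesis/ValiantsHypothesis forces the duplicated namespace component
set_option linter.dupNamespace false

namespace Summit.ValiantsHypothesis.ValiantsHypothesis.Theorems.LacunarySymmetroidMatrixDescartes

open Matrix Finset
open scoped BigOperators Topology

namespace Inertia

variable {ι : Type} [Fintype ι] [DecidableEq ι]

/-! ## §1 Non-singular scales next to a singular point -/

omit [Fintype ι] [DecidableEq ι] in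
/-- Points of a finite set other than `t₀` stay away from `t₀`. [folklore] -/
theorem eventually_not_mem_erase (T : Finset ℝ) (t₀ : ℝ) : ∀ᶠ x in 𝓝 t₀, x ∉ T.erase t₀ := by
  have hopen : IsOpen ((↑(T.erase t₀) : Set ℝ)ᶜ) := (T.erase t₀).finite_toSet.isClosed.isOpen_compl
  have hmem : t₀ ∈ ((↑(T.erase t₀) : Set ℝ)ᶜ) := by simp
  exact (hopen.eventually_mem hmem).mono fun x hx hxT => hx (Finset.mem_coe.2 hxT)

omit [Fintype ι] [DecidableEq ι] in
/-- **Left realising scale.**  If a property `P` holds for all `x < t₀` near `t₀`, then for every `a < t₀` there is `a' ∈ (a, t₀)`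
with `P a'` and NO point of the finite set `T` in `[a', t₀)`. [folklore] -/
theorem exists_point_left (T : Finset ℝ) {a t₀ : ℝ} (hat : a < t₀) {P : ℝ → Prop} (hP : ∀ᶠ x in 𝓝[<] t₀, P x) :
    ∃ a', a < a' ∧ a' < t₀ ∧ P a' ∧ ∀ t ∈ T, a' ≤ t → t < t₀ → False := by
  rw [eventually_nhdsWithin_iff] at hP
  obtain ⟨ε, hε, hεP⟩ := Metric.eventually_nhds_iff.1 (hP.and (eventually_not_mem_erase T t₀))
  obtain ⟨a', ha', ha'd⟩ := exists_mem_Ioo_near_right hat hε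
  refine ⟨a', ha'.1, ha'.2, (hεP ha'd).1 ha'.2, fun t ht hat' htt => ?_⟩
  have hd : dist t t₀ < ε := by
    rw [Real.dist_eq, abs_lt]
    rw [Real.dist_eq, abs_lt] at ha'd
    constructor <;> linarith
  exact (hεP hd).2 (Finset.mem_erase.2 ⟨ne_of_lt htt, ht⟩)

omit [Fintype ι] [DecidableEq ι] in
/-- **Right realising scale.** [folklore] -/
theorem exists_point_right (T : Finset ℝ) {t₀ b : ℝ} (htb : t₀ < b) {P : ℝ → Prop} (hP : ∀ᶠ x in 𝓝[>] t₀, P x) :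
    ∃ b', t₀ < b' ∧ b' < b ∧ P b' ∧ ∀ t ∈ T, t₀ < t → t ≤ b' → False := by
  rw [eventually_nhdsWithin_iff] at hP
  obtain ⟨ε, hε, hεP⟩ := Metric.eventually_nhds_iff.1 (hP.and (eventually_not_mem_erase T t₀))
  obtain ⟨b', hb', hb'd⟩ := exists_mem_Ioo_near_left htb hε
  refine ⟨b', hb'.1, hb'.2, (hεP hb'd).1 hb'.1, fun t ht htt htb' => ?_⟩
  have hd : dist t t₀ < ε := by
    rw [Real.dist_eq, abs_lt]
    rw [Real.dist_eq, abs_lt] at hb'd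
    constructor <;> linarith
  exact (hεP hd).2 (Finset.mem_erase.2 ⟨(ne_of_lt htt).symm, ht⟩)

/-! ## §2 Constancy on a singular-free closed window -/

/-- **No singular point in `[a, b]` ⇒ `ν(F b) = ν(F a)`.** [folklore] -/
theorem negIndex_eq_of_noRoot_Icc (F : ℝ → Matrix ι ι ℝ) (hF : ∀ i j, Continuous fun x => F x i j)
    (hH : ∀ x, (F x).IsHermitian) {a b : ℝ} (hab : a ≤ b) (hno : ∀ x ∈ Set.Icc a b, (F x).det ≠ 0) :
    Fintype.card {j // (hH b).eigenvalues j < 0} = Fintype.card {j // (hH a).eigenvalues j < 0} :=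
  DefiniteMoments.constant_of_nhds (I := fun t => Fintype.card {j // (hH t).eigenvalues j < 0}) isPreconnected_Icc
    (fun t ht => eventually_negIndex_eq F hF hH t (hno t ht)) (Set.right_mem_Icc.2 hab) (Set.left_mem_Icc.2 hab)

/-! ## §3 The index telescope -/

omit [Fintype ι] [DecidableEq ι] in
/-- Splitting the open-window sum around an isolated singular point `t₀`: with no point of `T` in `[a', t₀) ∪ (t₀, b']`,
`∑_{T ∩ (a,b)} f = ∑_{T ∩ (a,a')} f + f t₀ + ∑_{T ∩ (b',b)} f`. [folklore] -/
theorem sum_filter_Ioo_split3 (T : Finset ℝ) (f : ℝ → ℕ) {a a' t₀ b' b : ℝ} (haa' : a < a') (ha't : a' < t₀)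
    (htb' : t₀ < b') (hb'b : b' < b) (ht₀ : t₀ ∈ T) (hgapl : ∀ t ∈ T, a' ≤ t → t < t₀ → False)
    (hgapr : ∀ t ∈ T, t₀ < t → t ≤ b' → False) :
    ∑ t ∈ T.filter (fun t => a < t ∧ t < b), f t
      = ∑ t ∈ T.filter (fun t => a < t ∧ t < a'), f t + f t₀ + ∑ t ∈ T.filter (fun t => b' < t ∧ t < b), f t := by
  have hdecomp : T.filter (fun t => a < t ∧ t < b)
      = (T.filter (fun t => a < t ∧ t < a') ∪ {t₀}) ∪ T.filter (fun t => b' < t ∧ t < b) := by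
    ext t
    simp only [Finset.mem_filter, Finset.mem_union, Finset.mem_singleton]
    constructor
    · rintro ⟨htT, hat, htb⟩
      by_cases h1 : t < a'
      · exact Or.inl (Or.inl ⟨htT, hat, h1⟩)
      · by_cases h2 : t < t₀
        · exact (hgapl t htT (not_lt.1 h1) h2).elim
        · by_cases h3 : t = t₀
          · exact Or.inl (Or.inr h3)
          · have h4 : t₀ < t := lt_of_le_of_ne (not_lt.1 h2) (Ne.symm h3)
            by_cases h5 : t ≤ b'
            · exact (hgapr t htT h4 h5).elim
            · exact Or.inr ⟨htT, not_le.1 h5, htb⟩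
    · rintro ((⟨htT, hat, hta'⟩ | rfl) | ⟨htT, hb't, htb⟩)
      · exact ⟨htT, hat, by linarith⟩
      · exact ⟨ht₀, by linarith, by linarith⟩
      · exact ⟨htT, by linarith, htb⟩
  have hd1 : Disjoint (T.filter (fun t => a < t ∧ t < a')) {t₀} := by
    rw [Finset.disjoint_singleton_right, Finset.mem_filter]
    rintro ⟨-, -, h⟩; linarith
  have hd2 : Disjoint (T.filter (fun t => a < t ∧ t < a') ∪ {t₀}) (T.filter (fun t => b' < t ∧ t < b)) := by
    rw [Finset.disjoint_left]
    intro t ht ht'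
    rw [Finset.mem_filter] at ht'
    rcases Finset.mem_union.1 ht with h | h
    · rw [Finset.mem_filter] at h
      linarith [h.2.2, ht'.2.1]
    · rw [Finset.mem_singleton] at h
      linarith [ht'.2.1]
  rw [hdecomp, Finset.sum_union hd2, Finset.sum_union hd1, Finset.sum_singleton]

/-- Induction engine of the index telescope (on the number of interior singular points). [folklore] -/
theorem negIndex_telescope_aux (F : ℝ → Matrix ι ι ℝ) (hF : ∀ i j, Continuous fun x => F x i j)
    (hH : ∀ x, (F x).IsHermitian) (T : Finset ℝ) (jr jl : ℝ → ℕ) :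
    ∀ (n : ℕ) (a b : ℝ), a < b → (T.filter (fun t => a < t ∧ t < b)).card ≤ n →
      (∀ x ∈ Set.Icc a b, (F x).det = 0 → x ∈ T) → (F a).det ≠ 0 → (F b).det ≠ 0 →
      (∀ t ∈ T, a < t → t < b → ∀ᶠ x in 𝓝[>] t,
          Fintype.card {j // (hH x).eigenvalues j < 0} = Fintype.card {j // (hH t).eigenvalues j < 0} + jr t) →
      (∀ t ∈ T, a < t → t < b → ∀ᶠ x in 𝓝[<] t,
          Fintype.card {j // (hH x).eigenvalues j < 0} = Fintype.card {j // (hH t).eigenvalues j < 0} + jl t) →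
      Fintype.card {j // (hH b).eigenvalues j < 0} + ∑ t ∈ T.filter (fun t => a < t ∧ t < b), jl t
        = Fintype.card {j // (hH a).eigenvalues j < 0} + ∑ t ∈ T.filter (fun t => a < t ∧ t < b), jr t := by
  intro n
  induction n with
  | zero =>
    intro a b hab hcard hT ha hb _ _
    have hemp : T.filter (fun t => a < t ∧ t < b) = ∅ := Finset.card_eq_zero.1 (Nat.le_zero.1 hcard)
    rw [hemp, Finset.sum_empty, Finset.sum_empty, add_zero, add_zero]
    refine negIndex_eq_of_noRoot_Icc F hF hH hab.le fun x hx hdet => ?_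
    rcases eq_or_lt_of_le hx.1 with rfl | hax
    · exact ha hdet
    rcases eq_or_lt_of_le hx.2 with rfl | hxb
    · exact hb hdet
    have : x ∈ T.filter (fun t => a < t ∧ t < b) := Finset.mem_filter.2 ⟨hT x hx hdet, hax, hxb⟩
    rw [hemp] at this
    simp at this
  | succ n ih =>
    intro a b hab hcard hT ha hb hjr hjl
    by_cases hne : (T.filter (fun t => a < t ∧ t < b)).Nonempty
    · obtain ⟨t₀, ht₀⟩ := hne
      obtain ⟨ht₀T, hat₀, ht₀b⟩ := Finset.mem_filter.1 ht₀
      -- realising scales on both sides of `t₀`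
      obtain ⟨a', haa', ha't, ha'v, hgapl⟩ := exists_point_left T hat₀ (hjl t₀ ht₀T hat₀ ht₀b)
      obtain ⟨b', htb', hb'b, hb'v, hgapr⟩ := exists_point_right T ht₀b (hjr t₀ ht₀T hat₀ ht₀b)
      have ha'T : a' ∉ T := fun h => hgapl a' h le_rfl ha't
      have hb'T : b' ∉ T := fun h => hgapr b' h htb' le_rfl
      have ha'det : (F a').det ≠ 0 := fun h => ha'T (hT a' ⟨haa'.le, by linarith⟩ h)
      have hb'det : (F b').det ≠ 0 := fun h => hb'T (hT b' ⟨by linarith, hb'b.le⟩ h)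
      -- the sub-windows carry fewer singular points
      have hsub1 : T.filter (fun t => a < t ∧ t < a') ⊆ (T.filter (fun t => a < t ∧ t < b)).erase t₀ := by
        intro t ht
        obtain ⟨htT, h1, h2⟩ := Finset.mem_filter.1 ht
        exact Finset.mem_erase.2 ⟨ne_of_lt (lt_trans h2 ha't), Finset.mem_filter.2 ⟨htT, h1, by linarith⟩⟩
      have hsub2 : T.filter (fun t => b' < t ∧ t < b) ⊆ (T.filter (fun t => a < t ∧ t < b)).erase t₀ := by
        intro t ht
        obtain ⟨htT, h1, h2⟩ := Finset.mem_filter.1 ht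
        exact Finset.mem_erase.2 ⟨(ne_of_lt (lt_trans htb' h1)).symm, Finset.mem_filter.2 ⟨htT, by linarith, h2⟩⟩
      have hce := Finset.card_erase_of_mem ht₀
      have hc1 : (T.filter (fun t => a < t ∧ t < a')).card ≤ n := by
        have := Finset.card_le_card hsub1; omega
      have hc2 : (T.filter (fun t => b' < t ∧ t < b)).card ≤ n := by
        have := Finset.card_le_card hsub2; omega
      have h1 := ih a a' haa' hc1 (fun x hx hdx => hT x ⟨hx.1, by linarith [hx.2]⟩ hdx) ha ha'det
        (fun t ht h1 h2 => hjr t ht h1 (by linarith)) (fun t ht h1 h2 => hjl t ht h1 (by linarith))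
      have h2 := ih b' b hb'b hc2 (fun x hx hdx => hT x ⟨by linarith [hx.1], hx.2⟩ hdx) hb'det hb
        (fun t ht h1 h2 => hjr t ht (by linarith) h2) (fun t ht h1 h2 => hjl t ht (by linarith) h2)
      rw [sum_filter_Ioo_split3 T jl haa' ha't htb' hb'b ht₀T hgapl hgapr,
        sum_filter_Ioo_split3 T jr haa' ha't htb' hb'b ht₀T hgapl hgapr]
      -- `ha'v : ν(F a') = ν(F t₀) + jl t₀`, `hb'v : ν(F b') = ν(F t₀) + jr t₀`
      omega
    · rw [Finset.not_nonempty_iff_eq_empty] at hne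
      exact ih a b hab (by rw [hne]; simp) hT ha hb hjr hjl

/-- **THE INDEX TELESCOPE (negative index).**  `F` entrywise continuous and hermitian, `a < b` non-singular scales, `T` a
finite set containing every singular point of `F` in `[a, b]`, and at every `t ∈ T ∩ (a, b)` exact one-sided jumps
`ν(t⁺) = ν(F t) + jr t`, `ν(t⁻) = ν(F t) + jl t`.  Then `ν(F b) + ∑_{T ∩ (a,b)} jl = ν(F a) + ∑_{T ∩ (a,b)} jr`. [folklore] -/
theorem negIndex_telescope (F : ℝ → Matrix ι ι ℝ) (hF : ∀ i j, Continuous fun x => F x i j)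
    (hH : ∀ x, (F x).IsHermitian) (T : Finset ℝ) (jr jl : ℝ → ℕ) {a b : ℝ} (hab : a < b)
    (hT : ∀ x ∈ Set.Icc a b, (F x).det = 0 → x ∈ T) (ha : (F a).det ≠ 0) (hb : (F b).det ≠ 0)
    (hjr : ∀ t ∈ T, a < t → t < b → ∀ᶠ x in 𝓝[>] t,
      Fintype.card {j // (hH x).eigenvalues j < 0} = Fintype.card {j // (hH t).eigenvalues j < 0} + jr t)
    (hjl : ∀ t ∈ T, a < t → t < b → ∀ᶠ x in 𝓝[<] t,
      Fintype.card {j // (hH x).eigenvalues j < 0} = Fintype.card {j // (hH t).eigenvalues j < 0} + jl t) :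
    Fintype.card {j // (hH b).eigenvalues j < 0} + ∑ t ∈ T.filter (fun t => a < t ∧ t < b), jl t
      = Fintype.card {j // (hH a).eigenvalues j < 0} + ∑ t ∈ T.filter (fun t => a < t ∧ t < b), jr t :=
  negIndex_telescope_aux F hF hH T jr jl _ a b hab le_rfl hT ha hb hjr hjl

/-- **THE INDEX TELESCOPE (positive index).**  Same with `π` and jump data for `π`. [folklore] -/
theorem posIndex_telescope (F : ℝ → Matrix ι ι ℝ) (hF : ∀ i j, Continuous fun x => F x i j)
    (hH : ∀ x, (F x).IsHermitian) (T : Finset ℝ) (jr jl : ℝ → ℕ) {a b : ℝ} (hab : a < b)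
    (hT : ∀ x ∈ Set.Icc a b, (F x).det = 0 → x ∈ T) (ha : (F a).det ≠ 0) (hb : (F b).det ≠ 0)
    (hjr : ∀ t ∈ T, a < t → t < b → ∀ᶠ x in 𝓝[>] t,
      Fintype.card {j // 0 < (hH x).eigenvalues j} = Fintype.card {j // 0 < (hH t).eigenvalues j} + jr t)
    (hjl : ∀ t ∈ T, a < t → t < b → ∀ᶠ x in 𝓝[<] t,
      Fintype.card {j // 0 < (hH x).eigenvalues j} = Fintype.card {j // 0 < (hH t).eigenvalues j} + jl t) :
    Fintype.card {j // 0 < (hH b).eigenvalues j} + ∑ t ∈ T.filter (fun t => a < t ∧ t < b), jl t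
      = Fintype.card {j // 0 < (hH a).eigenvalues j} + ∑ t ∈ T.filter (fun t => a < t ∧ t < b), jr t := by
  have hH' : ∀ x, ((fun y => -F y) x).IsHermitian := fun x => (hH x).neg
  have hdet : ∀ x, (-F x).det ≠ 0 ↔ (F x).det ≠ 0 := fun x => by
    rw [Matrix.det_neg, mul_ne_zero_iff]
    exact ⟨fun h => h.2, fun h => ⟨pow_ne_zero _ (by norm_num), h⟩⟩
  have h := negIndex_telescope (fun y => -F y) (fun i j => (hF i j).neg) hH' T jr jl hab
    (fun x hx hdx => hT x hx (by
      by_contra h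
      exact ((hdet x).2 h) hdx)) ((hdet a).2 ha) ((hdet b).2 hb)
    (fun t ht h1 h2 => (hjr t ht h1 h2).mono fun x hx => by
      rw [← posIndex_eq_negIndex_neg (hH x) (hH' x), ← posIndex_eq_negIndex_neg (hH t) (hH' t)]; exact hx)
    (fun t ht h1 h2 => (hjl t ht h1 h2).mono fun x hx => by
      rw [← posIndex_eq_negIndex_neg (hH x) (hH' x), ← posIndex_eq_negIndex_neg (hH t) (hH' t)]; exact hx)
  rw [← posIndex_eq_negIndex_neg (hH b) (hH' b), ← posIndex_eq_negIndex_neg (hH a) (hH' a)] at h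
  exact h

end Inertia

end Summit.ValiantsHypothesis.ValiantsHypothesis.Theorems.LacunarySymmetroidMatrixDescartes
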